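import Summits.QuantumFields.BalabanUV.Beta.FP.KernelPeriodisationFibDec
import Summits.QuantumFields.BalabanUV.Beta.FP.RelInvCompression
import Summits.QuantumFields.BalabanUV.Beta.RelInvBorderedHessianStep
import Summits.QuantumFields.BalabanUV.Beta.D1BFx.SortedRelInv

/-!
# `BalabanUV.Beta.FP.RelInvPeriodised` — road «FP» (binder row D1), RULING R-FP-51 row **(T-INV-per)** (leaf-05's half of (T-INV), CORR-1
# [D1P3-G16-CORR-1]): **AN2'S FOUR RELATIVE-INVERSE RULES, PERIODISED, AT EVERY STEP `j`** — on every torus box `M` with `Lc ∣ M_i` the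
# periodised co-dressed resolvent `perF M (Π̂ᵀ (KInvStep Lc j) Π̂)`, the periodised candidate bordered Hessian `perF M (bhKStepAt d ρ Lc j)` and
# the periodised coarse axial coordinate projector `perF M (axEc ρ Lc)` obey `ÊÂ = Â = ÂÊ`, `ÂM̂Ê = Ê = ÊM̂Â`; `Ê` IS a 0∕1 diagonal, so in
# `per axEc`-coordinates (live ⊕ dead) the LIVE BLOCK of `M̂` has a unit determinant and its inverse is the live block of `Â`, which is all of `Â`

HONEST DEPENDENCY (page 1, mandatory): continuum YM on T⁴ ⇐ BetaPertH ∧ nine spine estimates (0/9 proved); BetaPertH ⇐ (D1) ∧ (D4) ∧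
CAP+tail; G-an2-4 gates asym, D1 and NE2/3/4.  HONEST FRAMING (cell contract, verbatim): «discharging `BetaPertH` makes Bałaban's UV
stability UNCONDITIONAL — a real constructive-QFT result; it is NOT the continuum limit and NOT the Clay problem.»  THIS MODULE is [folklore]
bookkeeping BY NAME over: gan24-p3's (T-PER) PART 2 `KernelPeriodisationFibDec.perF_relInv` (the four identities periodise, given spread +
`Mℤ^{d+1}`-invariance), leaf-03's (T-INV-fd) `RelInvCompression` §1 (four matrix rules w.r.t. `fromBlocks 1 0 0 0` ⇒ live block two-sided
inverse), an2's rules at every `j` `BorderedHessian.relInv_coDressKBmAt_KInvStep_bhKStepAt`, and road BF-x's block covariance lemmas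
`D1BFx.SortedRelInv.shiftK_bhK ∕ shiftK_axEc ∕ delta1_add`.  It mints no `Prop`, has no `def`, cites nothing, 0 sorry.
ABSOLUTE RULE (cell charter, verbatim): «No internally-minted statement may enter as a cited fact. Every hypothesis is either kernel-proved in this
package or a verbatim quotation of a PUBLISHED theorem with page reference. The manuscript(s) under audit are NOT citable for their own disputed
steps — they are the thing under adjudication; programme-internal (2001/route/tribunal) claims are never citable.»

CONTENT.  §1 (generic): `perF_of_siteDiag` (a SITE-DIAGONAL kernel periodises to its box restriction — no invariance needed),
`diagonal_indicator_submatrix_sumCompl` (sorting a 0∕1 diagonal by `Equiv.sumCompl P` gives `fromBlocks 1 0 0 0`), **`compress_of_rules`** (four matrix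
rules w.r.t. a 0∕1 diagonal `E` ⇒ after sorting live ⊕ dead: `IsUnit (M̂_live).det`, `(M̂_live)⁻¹ = Â_live`, `Â = fromBlocks Â_live 0 0 0` —
`RelInvCompression` §1 through `Matrix.submatrix_mul_equiv`).  §2 (block covariance): `shiftK_bhKAt` (the ROOTED bordered Hessian is `Nℤ^{d+1}`-covariant:
field block = `bhK`'s, borders by `AveragingContoursRooted.linAvgAt_add`), **`shiftK_bhKStepAt`** (every `j`: `BalabanStepJetsSucc.shiftK_E2` for the
field block), the `translate` forms.  §3 (the wall's instance, every `d`, every in-block root `r`, every `Lc ≥ 1`, every `j`, every box `M` with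
`Lc ∣ M_i`): `perF_axEc` (`Ê` = the diagonal of `axEc`'s own diagonal, entries in `{0,1}`), **`perF_rules_wall`** (the four matrix identities),
**`torus_relInv_compress`** (for ANY decidable `P` reading `axEc`'s diagonal — the consumer's live ∕ dead sorting: non-comb bonds ⊕ coarse
multipliers — the three conclusions of `compress_of_rules`), and the canonical sorting `torus_relInv_compress_canonical` (`P p := Ê p p = 1`).
WHAT IT IS FOR ∕ NOT: this is the owner's sentence «the sliced torus KKT in `per axEc`-coordinates is invertible with inverse the compressed `per`
of the co-dressed resolvent» in COMPRESSED (live-block) form; dressing the live block as the road's `kkt`∕`kBig` with comb-coordinate slice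
rows is `RelInvCompression` §2–§4b ∘ the block dictionary of `perF M (bhKStepAt …)` (leaf-06's dictionary row) — NOT here.  Discharges NO binder
of row D1 by itself; NOT (T-ID), NOT SDF, NOT D1, NOT BetaPertH, NOT continuum, NOT Clay.
Unit `b2b-balaban-beta-d1-formalise-leaf-05` (gen 23), 2026-08-21; no existing file touched.
-/

noncomputable section

open scoped BigOperators Matrix

namespace Summit.QuantumFields.BalabanUV.Beta.FP.RelInvPeriodised

open Literature.Probability.LatticeModels (Torus.proj)
open Literature.MathematicalPhysics.QuantumFieldTheory.LatticeForm (quo proj_add_zsmul)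
open Literature.MathematicalPhysics.QuantumFieldTheory.Balaban1983to89
open Literature.MathematicalPhysics.QuantumFieldTheory.Balaban1983to89.Beta
open B4TorusKernel.MultiPeriod (translate translate_apply)
open B6Lemma24Torus (pbox IsPeriod)
open B6Cov2156Torus (eq_of_mem_pbox_of_isPeriod)
open ExpKernelCalculus (MKer Decays shiftK)
open AffineAveraging (box toSite)
open AveragingContours (shift)
open AveragingContoursRooted (linAvgAt linAvgAt_add)
open KKTFluctuationKernel (delta1 delta1_apply)
open OneStepResolventKernel (Fib)
open OneStepKernelFamily (KInvStep)
open BalabanStepJetsSucc (E2 shiftK_E2 wVH)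
open Summit.QuantumFields.BalabanUV.Beta.TameKernelCalculus (Spr)
open Summit.QuantumFields.BalabanUV.Beta.ChartConjugationRelative (RelInv)
open Summit.QuantumFields.BalabanUV.Beta.AxialDressingRooted (coDressKBmAt axEc axEc_inl_inl axEc_inl_inr axEc_inr_inl axEc_inr_inr spr_axEc one_le_of_neZero
  decays_coDressKBmAt_KInvStep shiftK_coDressKBmAt_KInvStep)
open Summit.QuantumFields.BalabanUV.Beta.BorderedHessian (bhK bhKAt bhKAt_inl_inl bhKAt_inl_inr bhKAt_inr_inl bhKAt_inr_inr bhKStepAt bhKStepAt_zero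
  bhKStepAt_succ_inl_inl bhKStepAt_succ_fm bhKStepAt_succ_mf bhKStepAt_succ_mm stepScale spr_bhKStepAt relInv_coDressKBmAt_KInvStep_bhKStepAt)
open Summit.QuantumFields.BalabanUV.Beta.D1BFx.SortedRelInv (shiftK_bhK shiftK_axEc delta1_add)
open Summit.QuantumFields.BalabanUV.Beta.FP.KernelPeriodisationFib (Idx perF perF_apply perZ_apply translate_invariant_of_shiftK)
open Summit.QuantumFields.BalabanUV.Beta.FP.KernelPeriodisationFibDec (perF_relInv)
open Summit.QuantumFields.BalabanUV.Beta.FP.RelInvCompression (eq_fromBlocks_of_proj isUnit_det_toBlocks₁₁_of_relInv inv_toBlocks₁₁_of_relInv)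
open Summit.QuantumFields.BalabanUV.Beta.GAN24.DirichletExhaustionPeriodise (one_le_M)

variable {d : ℕ} {F : Type*}

/-! ## §1 Generic: site-diagonal kernels, sorting a 0∕1 diagonal, compression from the four matrix rules -/

/-- [folklore] **A SITE-DIAGONAL KERNEL PERIODISES TO ITS BOX RESTRICTION**: if `K x y = 0` for `x ≠ y` then `perF M K (r,a) (s,b) = [r = s]·K r r a b`
(two box representatives differ by a period vector only trivially; no invariance or decay needed). -/
theorem perF_of_siteDiag (M : Fin (d + 1) → ℕ) [∀ μ, NeZero (M μ)] {K : MKer (d + 1) F}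
    (hK : ∀ (x y : Fin (d + 1) → ℤ) (a b : F), x ≠ y → K x y a b = 0) (p q : Idx M F) :
    perF M K p q = if (p.1 : Fin (d + 1) → ℤ) = q.1 then K p.1 p.1 p.2 q.2 else 0 := by
  have h0 : translate M (q.1 : Fin (d + 1) → ℤ) 0 = q.1 := by
    funext i; simp only [translate_apply, Pi.zero_apply, mul_zero, add_zero]
  rw [perF_apply, perZ_apply, tsum_eq_single 0]
  · rw [h0]
    by_cases h : (p.1 : Fin (d + 1) → ℤ) = q.1
    · rw [if_pos h, h]
    · rw [if_neg h, hK _ _ _ _ h]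
  · intro m hm
    refine hK _ _ _ _ fun h => hm ?_
    have hper : IsPeriod M ((p.1 : Fin (d + 1) → ℤ) - q.1) := fun i =>
      ⟨m i, by rw [Pi.sub_apply, h, translate_apply]; ring⟩
    have hpq : (p.1 : Fin (d + 1) → ℤ) = q.1 := eq_of_mem_pbox_of_isPeriod p.1.2 q.1.2 hper
    rw [hpq] at h
    exact (B4TorusKernel.MultiPeriod.translate_injective (one_le_M M) (q.1 : Fin (d + 1) → ℤ) (h0.trans h)).symm

/-- [folklore] **SORTING A 0∕1 DIAGONAL**: along `Equiv.sumCompl P` (the `P`-coordinates first) the diagonal indicator of `P` is `fromBlocks 1 0 0 0`. -/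
theorem diagonal_indicator_submatrix_sumCompl {ι : Type*} [DecidableEq ι] (P : ι → Prop) [DecidablePred P] :
    (Matrix.diagonal fun i => if P i then (1 : ℝ) else 0).submatrix (Equiv.sumCompl P) (Equiv.sumCompl P)
      = Matrix.fromBlocks 1 0 0 0 := by
  ext (i | i) (j | j)
  · rw [Matrix.submatrix_apply, Equiv.sumCompl_apply_inl, Equiv.sumCompl_apply_inl, Matrix.fromBlocks_apply₁₁]
    by_cases h : i = j
    · subst h
      rw [Matrix.diagonal_apply_eq, if_pos i.2, Matrix.one_apply_eq]
    · rw [Matrix.diagonal_apply_ne _ (fun e => h (Subtype.ext e)), Matrix.one_apply_ne h]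
  · rw [Matrix.submatrix_apply, Equiv.sumCompl_apply_inl, Equiv.sumCompl_apply_inr, Matrix.fromBlocks_apply₁₂, Matrix.zero_apply,
      Matrix.diagonal_apply_ne]
    exact fun e => j.2 (e ▸ i.2)
  · rw [Matrix.submatrix_apply, Equiv.sumCompl_apply_inr, Equiv.sumCompl_apply_inl, Matrix.fromBlocks_apply₂₁, Matrix.zero_apply,
      Matrix.diagonal_apply_ne]
    exact fun e => i.2 (e ▸ j.2)
  · rw [Matrix.submatrix_apply, Equiv.sumCompl_apply_inr, Equiv.sumCompl_apply_inr, Matrix.fromBlocks_apply₂₂, Matrix.zero_apply]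
    by_cases h : (i : ι) = j
    · rw [h, Matrix.diagonal_apply_eq, if_neg j.2]
    · rw [Matrix.diagonal_apply_ne _ h]

/-- [folklore] **COMPRESSION FROM THE FOUR MATRIX RULES**: on a finite index, if `E` is the diagonal indicator of `P` and `E·A = A`, `A·E = A`, `A·𝕄·E = E`,
`E·𝕄·A = E`, then after sorting live ⊕ dead along `Equiv.sumCompl P`: the live block of `𝕄` has a unit determinant, its inverse is the live block
of `A`, and `A` is its live block padded by zeros (`RelInvCompression` §1, transported by `Matrix.submatrix_mul_equiv`). -/
theorem compress_of_rules {ι : Type*} [Fintype ι] [DecidableEq ι] (P : ι → Prop) [DecidablePred P] {A Mh E : Matrix ι ι ℝ}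
    (hE : E = Matrix.diagonal fun i => if P i then (1 : ℝ) else 0)
    (h1 : E * A = A) (h2 : A * E = A) (h3 : A * Mh * E = E) (h4 : E * Mh * A = E) :
    IsUnit ((Mh.submatrix (Equiv.sumCompl P) (Equiv.sumCompl P)).toBlocks₁₁).det
      ∧ ((Mh.submatrix (Equiv.sumCompl P) (Equiv.sumCompl P)).toBlocks₁₁)⁻¹ = (A.submatrix (Equiv.sumCompl P) (Equiv.sumCompl P)).toBlocks₁₁
      ∧ A.submatrix (Equiv.sumCompl P) (Equiv.sumCompl P)
          = Matrix.fromBlocks ((A.submatrix (Equiv.sumCompl P) (Equiv.sumCompl P)).toBlocks₁₁) 0 0 0 := by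
  set s := Equiv.sumCompl P with hs
  have hEs : E.submatrix s s = Matrix.fromBlocks 1 0 0 0 := by rw [hE]; exact diagonal_indicator_submatrix_sumCompl P
  have mul_sub : ∀ X Y : Matrix ι ι ℝ, (X * Y).submatrix s s = X.submatrix s s * Y.submatrix s s :=
    fun X Y => (Matrix.submatrix_mul_equiv X Y s s s).symm
  have h1' : Matrix.fromBlocks 1 0 0 0 * A.submatrix s s = A.submatrix s s := by
    rw [← hEs, ← mul_sub, h1]
  have h2' : A.submatrix s s * Matrix.fromBlocks 1 0 0 0 = A.submatrix s s := by
    rw [← hEs, ← mul_sub, h2]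
  have h3' : A.submatrix s s * Mh.submatrix s s * Matrix.fromBlocks 1 0 0 0 = Matrix.fromBlocks 1 0 0 0 := by
    rw [← hEs, ← mul_sub, ← mul_sub, h3]
  have h4' : Matrix.fromBlocks 1 0 0 0 * Mh.submatrix s s * A.submatrix s s = Matrix.fromBlocks 1 0 0 0 := by
    rw [← hEs, ← mul_sub, ← mul_sub, h4]
  exact ⟨isUnit_det_toBlocks₁₁_of_relInv h1' h2' h3' h4', inv_toBlocks₁₁_of_relInv h1' h2' h3' h4', eq_fromBlocks_of_proj h2' h1'⟩

/-! ## §2 Block covariance of the rooted and of the step-`j` candidate bordered Hessians -/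

section Covariance

variable (ρ : Fin (d + 1) → ℤ)

/-- [folklore] **THE ROOTED BORDERED HESSIAN IS BLOCK COVARIANT**: `shiftK (N•t) (bhKAt d ρ N) = bhKAt d ρ N` (field block = `bhK`'s; borders: the rooted
linearised averaging commutes with coarse translations, `linAvgAt_add`). -/
theorem shiftK_bhKAt (N : ℕ) [NeZero N] (t : Fin (d + 1) → ℤ) : shiftK ((N : ℤ) • t) (bhKAt d ρ N) = bhKAt d ρ N := by
  have hsh : ∀ (κ : Fin (d + 1)) (x : Fin (d + 1) → ℤ), shift ((N : ℤ) • t) (delta1 κ (x + (N : ℤ) • t)) = delta1 κ x := by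
    intro κ x
    funext μ z
    rw [delta1_add]
    simp only [shift, add_sub_cancel_right]
  funext x y a b
  rcases a with κ | κ <;> rcases b with l | l
  · have h := congrFun (congrFun (congrFun (congrFun (shiftK_bhK (N := N) t) x) y) (Sum.inl κ)) (Sum.inl l)
    simp only [ExpKernelCalculus.shiftK] at h ⊢
    rw [bhKAt_inl_inl, bhKAt_inl_inl, h]
  · simp only [ExpKernelCalculus.shiftK]
    rw [bhKAt_inl_inr, bhKAt_inl_inr, proj_add_zsmul, D1BFx.SortedReblocking.quo_add_zsmul, linAvgAt_add, hsh]
  · simp only [ExpKernelCalculus.shiftK]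
    rw [bhKAt_inr_inl, bhKAt_inr_inl, proj_add_zsmul, D1BFx.SortedReblocking.quo_add_zsmul, linAvgAt_add, hsh]
  · simp only [ExpKernelCalculus.shiftK]
    rw [bhKAt_inr_inr, bhKAt_inr_inr]

/-- [folklore] **THE STEP-`j` CANDIDATE IS BLOCK COVARIANT**, every `j`: `shiftK (Lc•t) (bhKStepAt d ρ Lc j) = bhKStepAt d ρ Lc j` (`j = 0`: `shiftK_bhKAt`;
`j + 1`: the field block `wVH·E2` is invariant under every unit translation (`shiftK_E2`), the borders are `stepScale·` those of `bhKAt`, the corner is `0`). -/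
theorem shiftK_bhKStepAt (Lc : ℕ) [NeZero Lc] (t : Fin (d + 1) → ℤ) : ∀ j : ℕ, shiftK ((Lc : ℤ) • t) (bhKStepAt d ρ Lc j) = bhKStepAt d ρ Lc j
  | 0 => by rw [bhKStepAt_zero]; exact shiftK_bhKAt ρ Lc t
  | j + 1 => by
    have hA := shiftK_bhKAt (d := d) ρ Lc t
    have hE := shiftK_E2 (d := d) (Lc := Lc) (j + 1) ((Lc : ℤ) • t)
    funext x y a b
    have hA' := congrFun (congrFun (congrFun (congrFun hA x) y) a) b
    have hE' := congrFun (congrFun (congrFun (congrFun hE x) y) a) b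
    simp only [ExpKernelCalculus.shiftK] at hA' hE' ⊢
    rcases a with κ | κ <;> rcases b with l | l
    · rw [bhKStepAt_succ_inl_inl, bhKStepAt_succ_inl_inl, hE']
    · rw [bhKStepAt_succ_fm, bhKStepAt_succ_fm, hA']
    · rw [bhKStepAt_succ_mf, bhKStepAt_succ_mf, hA']
    · rw [bhKStepAt_succ_mm, bhKStepAt_succ_mm]

/-- [folklore] `translate` form: the step-`j` candidate is invariant under every period lattice `Mℤ^{d+1}` with `Lc ∣ M_i`. -/
theorem bhKStepAt_translate_invariant (Lc : ℕ) [NeZero Lc] (j : ℕ) (M : Fin (d + 1) → ℕ) (hM : ∀ i, Lc ∣ M i)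
    (m x y : Fin (d + 1) → ℤ) (a b : Fib d) :
    bhKStepAt d ρ Lc j (translate M x m) (translate M y m) a b = bhKStepAt d ρ Lc j x y a b :=
  translate_invariant_of_shiftK M (fun t => shiftK_bhKStepAt ρ Lc t j) hM m x y a b

/-- [folklore] `translate` form for the coarse axial coordinate projector (`D1BFx.SortedRelInv.shiftK_axEc`). -/
theorem axEc_translate_invariant (Lc : ℕ) [NeZero Lc] (M : Fin (d + 1) → ℕ) (hM : ∀ i, Lc ∣ M i)
    (m x y : Fin (d + 1) → ℤ) (a b : Fib d) :
    axEc ρ Lc (translate M x m) (translate M y m) a b = axEc ρ Lc x y a b :=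
  translate_invariant_of_shiftK M (fun t => shiftK_axEc (N := Lc) ρ t) hM m x y a b

/-- [folklore] `translate` form for the co-dressed step-`j` resolvent (`AxialDressingRooted.shiftK_coDressKBmAt_KInvStep`). -/
theorem coDressKBmAt_KInvStep_translate_invariant (Lc : ℕ) [NeZero Lc] (j : ℕ) (M : Fin (d + 1) → ℕ) (hM : ∀ i, Lc ∣ M i)
    (m x y : Fin (d + 1) → ℤ) (a b : Fib d) :
    coDressKBmAt ρ Lc (KInvStep (d := d) Lc j) (translate M x m) (translate M y m) a b
      = coDressKBmAt ρ Lc (KInvStep (d := d) Lc j) x y a b := by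
  refine translate_invariant_of_shiftK M (fun t => ?_) hM m x y a b
  have h := shiftK_coDressKBmAt_KInvStep (d := d) (Lc := Lc) ρ j (-t)
  rwa [smul_neg, neg_neg] at h

end Covariance

/-! ## §3 The wall's instance: every `d`, every in-block root, every `Lc ≥ 1`, every step `j`, every torus box `M` with `Lc ∣ M_i` -/

section Wall

variable {Lc : ℕ} [NeZero Lc] {r : Fin (d + 1) → ℕ} (M : Fin (d + 1) → ℕ) [∀ μ, NeZero (M μ)]

/-- [folklore] `axEc` is site-diagonal. -/
theorem axEc_off_diag (ρ : Fin (d + 1) → ℤ) (N : ℕ) (x y : Fin (d + 1) → ℤ) (a b : Fib d) (hxy : x ≠ y) : axEc ρ N x y a b = 0 := by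
  rcases a with α | m <;> rcases b with β | m'
  · rw [axEc_inl_inl, if_neg fun h => hxy h.1]
  · rw [axEc_inl_inr]
  · rw [axEc_inr_inl]
  · rw [axEc_inr_inr, if_neg fun h => hxy h.1]

/-- [folklore] The diagonal entries of `axEc` are `0` or `1`, and its fibre-off-diagonal entries on the site diagonal vanish. -/
theorem axEc_diag_apply (ρ : Fin (d + 1) → ℤ) (N : ℕ) (x : Fin (d + 1) → ℤ) (a b : Fib d) :
    axEc ρ N x x a b = if a = b then axEc ρ N x x a a else 0 := by
  rcases a with α | m <;> rcases b with β | m'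
  · by_cases h : α = β
    · subst h; rw [if_pos rfl]
    · rw [if_neg fun e => h (Sum.inl_injective e), axEc_inl_inl, if_neg fun h' => h h'.2.1]
  · rw [axEc_inl_inr, if_neg Sum.inl_ne_inr]
  · rw [axEc_inr_inl, if_neg Sum.inr_ne_inl]
  · by_cases h : m = m'
    · subst h; rw [if_pos rfl]
    · rw [if_neg fun e => h (Sum.inr_injective e), axEc_inr_inr, if_neg fun h' => h h'.2.1]

/-- [folklore] `axEc`'s diagonal is `{0,1}`-valued. -/
theorem axEc_diag_zero_or_one (ρ : Fin (d + 1) → ℤ) (N : ℕ) (x : Fin (d + 1) → ℤ) (a : Fib d) :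
    axEc ρ N x x a a = 0 ∨ axEc ρ N x x a a = 1 := by
  rcases a with α | m
  · rw [axEc_inl_inl]; split_ifs <;> simp
  · rw [axEc_inr_inr]; split_ifs <;> simp

/-- [folklore] **`Ê` IS THE DIAGONAL OF `axEc`'S OWN DIAGONAL**: `perF M (axEc ρ N) = diagonal (p ↦ axEc ρ N p̃ p̃ p.2 p.2)` (site-diagonal kernel, §1). -/
theorem perF_axEc (ρ : Fin (d + 1) → ℤ) (N : ℕ) :
    perF M (axEc ρ N) = Matrix.diagonal fun p : Idx M (Fib d) => axEc ρ N p.1 p.1 p.2 p.2 := by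
  ext p q
  rw [perF_of_siteDiag M (fun x y a b h => axEc_off_diag ρ N x y a b h)]
  by_cases hpq : p = q
  · subst hpq; rw [if_pos rfl, Matrix.diagonal_apply_eq]
  · rw [Matrix.diagonal_apply_ne _ hpq]
    by_cases h1 : (p.1 : Fin (d + 1) → ℤ) = q.1
    · rw [if_pos h1, axEc_diag_apply, if_neg]
      exact fun h2 => hpq (Prod.ext (Subtype.ext h1) h2)
    · rw [if_neg h1]

/-- [folklore] **THE FOUR MATRIX RULES ON THE TORUS BOX** (an2's `relInv_coDressKBmAt_KInvStep_bhKStepAt` through gan24-p3's `perF_relInv`; spread: an2's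
`decays_coDressKBmAt_KInvStep`, `spr_bhKStepAt`, `spr_axEc`; invariance: §2): with `Â := perF M (Π̂ᵀ(KInvStep Lc j)Π̂)`, `M̂ := perF M (bhKStepAt d ρ Lc j)`,
`Ê := perF M (axEc ρ Lc)`, `ρ = toSite r`: `Ê·Â = Â`, `Â·Ê = Â`, `Â·M̂·Ê = Ê`, `Ê·M̂·Â = Ê`. -/
theorem perF_rules_wall (hr : r ∈ box (d + 1) Lc) (hM : ∀ i, Lc ∣ M i) (j : ℕ) :
    perF M (axEc (toSite r) Lc) * perF M (coDressKBmAt (toSite r) Lc (KInvStep (d := d) Lc j))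
        = perF M (coDressKBmAt (toSite r) Lc (KInvStep (d := d) Lc j))
      ∧ perF M (coDressKBmAt (toSite r) Lc (KInvStep (d := d) Lc j)) * perF M (axEc (toSite r) Lc)
        = perF M (coDressKBmAt (toSite r) Lc (KInvStep (d := d) Lc j))
      ∧ perF M (coDressKBmAt (toSite r) Lc (KInvStep (d := d) Lc j)) * perF M (bhKStepAt d (toSite r) Lc j) * perF M (axEc (toSite r) Lc)
        = perF M (axEc (toSite r) Lc)
      ∧ perF M (axEc (toSite r) Lc) * perF M (bhKStepAt d (toSite r) Lc j) * perF M (coDressKBmAt (toSite r) Lc (KInvStep (d := d) Lc j))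
        = perF M (axEc (toSite r) Lc) := by
  obtain ⟨δ, C, hδ, -, hA⟩ := decays_coDressKBmAt_KInvStep (d := d) (Lc := Lc) hr j
  exact perF_relInv M ⟨C, δ, hδ, hA⟩ (spr_bhKStepAt hr j) (spr_axEc _ _)
    (coDressKBmAt_KInvStep_translate_invariant (toSite r) Lc j M hM) (bhKStepAt_translate_invariant (toSite r) Lc j M hM)
    (axEc_translate_invariant (toSite r) Lc M hM) (relInv_coDressKBmAt_KInvStep_bhKStepAt hr j)

/-- **[folklore] (T-INV) ON THE TORUS, COMPRESSED FORM — EVERY STEP `j`.**  Let `P` be any decidable reading of `axEc`'s diagonal on the torus box index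
(`hP`; the consumer's live set: non-comb bonds ⊕ coarse multipliers) and sort live ⊕ dead along `Equiv.sumCompl P`.  Then the LIVE BLOCK of the
periodised step-`j` candidate bordered Hessian `perF M (bhKStepAt d ρ Lc j)` has a unit determinant, its inverse is the live block of the periodised
co-dressed resolvent `perF M (Π̂ᵀ(KInvStep Lc j)Π̂)`, and the latter is its live block padded by zeros. -/
theorem torus_relInv_compress (hr : r ∈ box (d + 1) Lc) (hM : ∀ i, Lc ∣ M i) (j : ℕ) (P : Idx M (Fib d) → Prop) [DecidablePred P]
    (hP : ∀ p : Idx M (Fib d), axEc (toSite r) Lc p.1 p.1 p.2 p.2 = if P p then 1 else 0) :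
    IsUnit (((perF M (bhKStepAt d (toSite r) Lc j)).submatrix (Equiv.sumCompl P) (Equiv.sumCompl P)).toBlocks₁₁).det
      ∧ (((perF M (bhKStepAt d (toSite r) Lc j)).submatrix (Equiv.sumCompl P) (Equiv.sumCompl P)).toBlocks₁₁)⁻¹
          = ((perF M (coDressKBmAt (toSite r) Lc (KInvStep (d := d) Lc j))).submatrix (Equiv.sumCompl P) (Equiv.sumCompl P)).toBlocks₁₁
      ∧ (perF M (coDressKBmAt (toSite r) Lc (KInvStep (d := d) Lc j))).submatrix (Equiv.sumCompl P) (Equiv.sumCompl P)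
          = Matrix.fromBlocks
              (((perF M (coDressKBmAt (toSite r) Lc (KInvStep (d := d) Lc j))).submatrix (Equiv.sumCompl P) (Equiv.sumCompl P)).toBlocks₁₁) 0 0 0 := by
  obtain ⟨h1, h2, h3, h4⟩ := perF_rules_wall M hr hM j
  refine compress_of_rules P ?_ h1 h2 h3 h4
  rw [perF_axEc]
  congr 1
  funext p
  exact hP p

open Classical in
/-- **[folklore] (T-INV) ON THE TORUS, CANONICAL SORTING**: `torus_relInv_compress` with the live set READ OFF `Ê` itself (`P p := axEc ρ Lc p̃ p̃ p.2 p.2 = 1`). -/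
theorem torus_relInv_compress_canonical (hr : r ∈ box (d + 1) Lc) (hM : ∀ i, Lc ∣ M i) (j : ℕ) :
    IsUnit (((perF M (bhKStepAt d (toSite r) Lc j)).submatrix
        (Equiv.sumCompl fun p : Idx M (Fib d) => axEc (toSite r) Lc p.1 p.1 p.2 p.2 = 1)
        (Equiv.sumCompl fun p : Idx M (Fib d) => axEc (toSite r) Lc p.1 p.1 p.2 p.2 = 1)).toBlocks₁₁).det
      ∧ (((perF M (bhKStepAt d (toSite r) Lc j)).submatrix
          (Equiv.sumCompl fun p : Idx M (Fib d) => axEc (toSite r) Lc p.1 p.1 p.2 p.2 = 1)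
          (Equiv.sumCompl fun p : Idx M (Fib d) => axEc (toSite r) Lc p.1 p.1 p.2 p.2 = 1)).toBlocks₁₁)⁻¹
          = ((perF M (coDressKBmAt (toSite r) Lc (KInvStep (d := d) Lc j))).submatrix
              (Equiv.sumCompl fun p : Idx M (Fib d) => axEc (toSite r) Lc p.1 p.1 p.2 p.2 = 1)
              (Equiv.sumCompl fun p : Idx M (Fib d) => axEc (toSite r) Lc p.1 p.1 p.2 p.2 = 1)).toBlocks₁₁ := by
  obtain ⟨h1, h2, -⟩ := torus_relInv_compress M hr hM j (fun p : Idx M (Fib d) => axEc (toSite r) Lc p.1 p.1 p.2 p.2 = 1) fun p => by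
    rcases axEc_diag_zero_or_one (toSite r) Lc (p.1 : Fin (d + 1) → ℤ) p.2 with h | h
    · rw [h, if_neg zero_ne_one]
    · rw [h, if_pos rfl]
  exact ⟨h1, h2⟩

end Wall

end Summit.QuantumFields.BalabanUV.Beta.FP.RelInvPeriodised

end
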